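import Summits.BirchSwinnertonDyer.Rank1Residual.Iwasawa.DatumSelmerLocalIndexFinite
import Literature.NumberTheory.EllipticCurves.GreenbergVatsal2000.NonPrimitiveDatumSelmerInvariants
import Literature.NumberTheory.EllipticCurves.IwasawaSelmerDualUniquenessProofs
import HarnessLib

/-!
# The Pontryagin dual `X₀ ↠ X` of `S^{S₁}_A(K_∞) ↪ S^{S₂}_A(K_∞)` for Greenberg–Vatsal's datum
# Selmer groups (`A = E[p^∞]`): forced `Λ`-action of a `DatumDualData`, naturality, the
# `Λ`-linear surjection with its kernel, and the dual-pair structure (TOOLS for row T-GV23-PA)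

HONEST FRAMING (cell `b2b-bsdres`, run/shared/lean/b2b/bsd-rank1-residual/, verbatim in every
file): the goal of the cell is to DELETE the COMBINATION-SHAPED residual classes of the
Birch–Swinnerton-Dyer formula for ALL analytic-rank `≤ 1` elliptic curves over `ℚ` — "full BSD
formula for every rank `≤ 1` curve in class `C`" assembled STRICTLY from published theorems — so
that the rank-`≤ 1` remainder becomes exactly the CONSTRUCTION-SHAPED classes, which are TYPED
(missing-input `Prop`s), NOT attempted. This is not "finishing BSD". Team n1011 (N10/N11; row
T-GV23-PA = the located gap P-α of the A240 derivation): research routes on CONSTRUCTION-SHAPED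
classes; prove what is provable now; no claim beyond stated classes; census output = EVIDENCE,
never a Literature fact; RESIDUAL-MAP marks UNCHANGED; nothing is booked by this file. TOOL
THEOREMS ONLY: no definition, no named fact; nothing cited enters as a hypothesis.

## What

For a number field `K`, an elliptic curve `E/K`, a prime `p`, a `ℤ_p`-extension `κ` with
topological generator `γ`, Greenberg data `L` for `A = E[p^∞]`, sets of places `S₁ ⊆ S₂`, and
Pontryagin-dual data (`GreenbergVatsal2000.DatumDualData`, T-GV23L's hypothesis structure) `X` of
`S^{S₁} = datumSelmerInfty κ A L S₁` and `X₀` of `S^{S₂}`: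

* `DatumDualData.toDual_smul` (§1): the `Λ`-action of ANY datum dual is the canonical one
  (`IsLocNil.smulFun` of `isLocNil_conjDatum_sub_one`) — port of the tree's
  `SelmerDualData.toDual_smul` / the cell's `NonPrimitiveDualData.toDual_smul` (K3).
* `datumSelmerInfty_mono`, `smulFun_comp_inclusion` (§2): `S^{S₁} ≤ S^{S₂}` and naturality of the
  canonical action along the inclusion.
* **`exists_restrictDual`** (§3): the dual `r : X₀ → X` of `S^{S₁} ↪ S^{S₂}` EXISTS as a `Λ`-LINEAR
  SURJECTION with `r x = 0 ↔ toDual x` kills `S^{S₁}` (existence form, no definition; onto by the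
  injectivity of `ℚ/ℤ`, Mathlib `CharacterModule.dual_surjective_of_injective`). GV 2000 Cor. (2.3):
  the dual of `0 → S_A → S^{Σ₀}_A`.
* `isDualPair_datumDualData` (§4): a datum dual is an `IwasawaDual.IsDualPair` for `ψ = conj_γ − 1`
  (so the tree's Nakayama lemma `IsDualPair.module_finite` and the cell's converse
  `finite_piece_one_of_isDualPair_of_moduleFinite` apply to it).

Consumer: `DatumSelmerNonPrimitiveInvariants` (END of row T-GV23-PA). Kernel note: equalities of
bundled homomorphisms on these `H¹`-subgroup types are proved through coercion lemmas /
pointwise, never by `rfl` on the structures (kernel defeq on `subgroupH1` types is expensive).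

References: R. Greenberg, V. Vatsal, Invent. Math. 142 (2000) §2 pp. 17, 20–21; R. Greenberg,
LNM 1716 §1 p. 60.
-/

noncomputable section

open scoped Classical AddSubgroup
open NumberField IsDedekindDomain Field
open Literature.NumberTheory.GaloisRepresentations Literature.NumberTheory.EllipticCurves
  Literature.NumberTheory.EllipticCurves.GreenbergSelmer
  Literature.NumberTheory.EllipticCurves.GreenbergVatsal2000
  Literature.NumberTheory.EllipticCurves.IwasawaDual

universe u

namespace Summit.BirchSwinnertonDyer.Rank1Residual.Iwasawa

/-! ## §1. The `Λ`-action of ANY datum dual is forced -/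

section Forced

variable {K : Type u} [Field K] [NumberField K] {W : WeierstrassCurve K} {p : ℕ} [Fact p.Prime]
  {κ : ZpExtension K p} {γ : absoluteGaloisGroup K} {L : Data K (W.geomPrimaryTorsion p) p}
  {S₁ : Set (HeightOneSpectrum (𝓞 K))}

/-- Induction carrier for `DatumDualData.toDual_smul` (port of the cell's
`NonPrimitiveDualData.toDual_smul_apply_of_pow_apply_eq_zero`): on classes killed by `ψ^N`,
`ψ = conj_γ − 1`, the action of any datum dual read through `toDual` is the canonical finite sum
`IsLocNil.smulFun`. [cite: GreenbergLNM1716, §1 (after Conj. 1.3)] -/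
theorem DatumDualData.toDual_smul_apply_of_pow_apply_eq_zero (hγ : κ.IsTopGenerator γ)
    (D : DatumDualData κ γ (W.geomPrimaryTorsion p) L S₁) (N : ℕ) :
    ∀ (s : datumSelmerInfty κ (W.geomPrimaryTorsion p) L S₁),
      ((conjDatum W κ L S₁ γ - 1) ^ N) s = 0 →
      ∀ (f : IwasawaAlgebra p) (x : D.X),
        D.toDual (f • x) s = (isLocNil_conjDatum_sub_one W κ L S₁ hγ).smulFun f (D.toDual x) s := by
  set h := isLocNil_conjDatum_sub_one W κ L S₁ hγ
  set ψ : AddMonoid.End (datumSelmerInfty κ (W.geomPrimaryTorsion p) L S₁) :=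
    conjDatum W κ L S₁ γ - 1 with hψ
  induction N with
  | zero =>
    intro s hs f x
    rw [pow_zero, AddMonoid.End.one_apply] at hs
    rw [hs, map_zero, map_zero]
  | succ N ih =>
    intro s hs f x
    obtain ⟨k, hk⟩ := h.torsion s
    have hψs : (ψ ^ N) (ψ s) = 0 := by
      rwa [pow_succ, AddMonoid.End.coe_mul, Function.comp_apply] at hs
    have hψeval : ∀ y : D.X, D.toDual y (ψ s) =
        D.toDual y ⟨conjH1 κ.kerSubgroup (W.geomPrimaryTorsion p) γ s,
          conjH1_mem_datumSelmer κ.kerSubgroup (W.geomPrimaryTorsion p) p L S₁ γ s.2⟩ -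
          D.toDual y s := fun y ↦ by
      rw [hψ, IwasawaDual.End_sub_apply, AddMonoid.End.one_apply, map_sub]
      rfl
    obtain ⟨g, a, hf⟩ : ∃ (g : IwasawaAlgebra p) (a : ℤ_[p]), f = PowerSeries.X * g + PowerSeries.C a :=
      ⟨_, _, PowerSeries.eq_X_mul_shift_add_const f⟩
    have lhs : D.toDual (f • x) s =
        D.toDual (g • x) (ψ s) + (PadicInt.toZModPow k a).val • D.toDual x s := by
      conv_lhs => rw [hf]
      rw [add_smul, mul_smul, map_add, AddMonoidHom.add_apply, D.toDual_T_smul,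
        D.toDual_C_smul a x s k hk, hψeval]
    have rhs : h.smulFun f (D.toDual x) s =
        h.smulFun g (D.toDual x) (ψ s) + (PadicInt.toZModPow k a).val • D.toDual x s := by
      conv_lhs => rw [hf]
      rw [h.smulFun_add_left, h.smulFun_mul_left, AddMonoidHom.add_apply, h.smulFun_X_apply,
        h.smulFun_C_apply a (D.toDual x) hk]
    exact lhs.trans ((congrArg (· + (PadicInt.toZModPow k a).val • D.toDual x s)
      (ih (ψ s) hψs g x)).trans rhs.symm)

/-- **The `Λ`-action of a `DatumDualData` is forced** (`γ` a topological generator): for any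
Pontryagin-dual datum `D` of `S^{S₁}_{E[p^∞]}(K_∞)` and all `f ∈ Λ`, `x ∈ X`:
`toDual (f • x) = f ⋆ toDual x` for the canonical action `IsLocNil.smulFun` attached to
`ψ = conj_γ − 1` (`isLocNil_conjDatum_sub_one`). Port of `SelmerDualData.toDual_smul` / the cell's
`NonPrimitiveDualData.toDual_smul`. [cite: GreenbergLNM1716, §1 (after Conj. 1.3)] -/
theorem DatumDualData.toDual_smul (hγ : κ.IsTopGenerator γ)
    (D : DatumDualData κ γ (W.geomPrimaryTorsion p) L S₁) (f : IwasawaAlgebra p) (x : D.X) :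
    D.toDual (f • x) = (isLocNil_conjDatum_sub_one W κ L S₁ hγ).smulFun f (D.toDual x) := by
  ext s
  obtain ⟨N, hN⟩ := (isLocNil_conjDatum_sub_one W κ L S₁ hγ).nil s
  exact DatumDualData.toDual_smul_apply_of_pow_apply_eq_zero hγ D N s hN f x

end Forced

/-! ## §2. Naturality of the canonical action along `S^{S₁} ↪ S^{S₂}` -/

section Naturality

variable {K : Type u} [Field K] [NumberField K] (W : WeierstrassCurve K) {p : ℕ} [Fact p.Prime]
  (κ : ZpExtension K p) (γ : absoluteGaloisGroup K) (L : Data K (W.geomPrimaryTorsion p) p)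
  {S₁ S₂ : Set (HeightOneSpectrum (𝓞 K))} (h12 : S₁ ⊆ S₂)

/-- `S^{T₁} ≤ S^{T₂}` for `T₁ ⊆ T₂` (GV p. 20 "Obviously, `S_A(ℚ_∞) ⊆ S^{Σ₀}_A(ℚ_∞)`"), in the
`datumSelmerInfty` spelling (the tree's `datumSelmer_mono`). [cite: GreenbergVatsal2000, §2 p. 20] -/
theorem datumSelmerInfty_mono {T₁ T₂ : Set (HeightOneSpectrum (𝓞 K))} (hT : T₁ ⊆ T₂)
    (M : Type u) [AddCommGroup M] [DistribMulAction (absoluteGaloisGroup K) M] [TopologicalSpace M]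
    [DiscreteTopology M] (L' : Data K M p) : datumSelmerInfty κ M L' T₁ ≤ datumSelmerInfty κ M L' T₂ :=
  datumSelmer_mono κ.kerSubgroup M p L' hT

/-- The inclusion `S^{S₁} ↪ S^{S₂}` intertwines `conj_γ` (both are `conjH1 γ` on the classes).
[folklore] -/
theorem inclusion_conjDatum (s : datumSelmerInfty κ (W.geomPrimaryTorsion p) L S₁) :
    AddSubgroup.inclusion (datumSelmerInfty_mono κ h12 (W.geomPrimaryTorsion p) L)
        (conjDatum W κ L S₁ γ s) =
      conjDatum W κ L S₂ γ
        (AddSubgroup.inclusion (datumSelmerInfty_mono κ h12 (W.geomPrimaryTorsion p) L) s) :=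
  Subtype.ext (by
    rw [AddSubgroup.coe_inclusion, coe_conjDatum_apply', coe_conjDatum_apply',
      AddSubgroup.coe_inclusion])

/-- The inclusion intertwines the powers of `ψ = conj_γ − 1`. [folklore] -/
theorem inclusion_conj_sub_one_pow_apply (i : ℕ)
    (s : datumSelmerInfty κ (W.geomPrimaryTorsion p) L S₁) :
    AddSubgroup.inclusion (datumSelmerInfty_mono κ h12 (W.geomPrimaryTorsion p) L)
        (((conjDatum W κ L S₁ γ - 1) ^ i) s) =
      ((conjDatum W κ L S₂ γ - 1) ^ i)
        (AddSubgroup.inclusion (datumSelmerInfty_mono κ h12 (W.geomPrimaryTorsion p) L) s) := by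
  induction i generalizing s with
  | zero => rw [pow_zero, pow_zero, AddMonoid.End.one_apply, AddMonoid.End.one_apply]
  | succ i ih =>
    rw [pow_succ, pow_succ, AddMonoid.End.coe_mul, AddMonoid.End.coe_mul, Function.comp_apply,
      Function.comp_apply, ih, IwasawaDual.End_sub_apply, IwasawaDual.End_sub_apply,
      AddMonoid.End.one_apply, AddMonoid.End.one_apply, map_sub, inclusion_conjDatum W κ γ L h12]

/-- **Naturality of the canonical `Λ`-action along `S^{S₁} ↪ S^{S₂}`**: restricting a character of
`S^{S₂}` to `S^{S₁}` commutes with `f ⋆ ·` (`γ` a topological generator). [folklore] -/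
theorem smulFun_comp_inclusion (hγ : κ.IsTopGenerator γ) (f : IwasawaAlgebra p)
    (x : datumSelmerInfty κ (W.geomPrimaryTorsion p) L S₂ →+ AddCircle (1 : ℚ)) :
    ((isLocNil_conjDatum_sub_one W κ L S₂ hγ).smulFun f x).comp
        (AddSubgroup.inclusion (datumSelmerInfty_mono κ h12 (W.geomPrimaryTorsion p) L)) =
      (isLocNil_conjDatum_sub_one W κ L S₁ hγ).smulFun f
        (x.comp (AddSubgroup.inclusion (datumSelmerInfty_mono κ h12 (W.geomPrimaryTorsion p) L))) := by
  set h₂ := isLocNil_conjDatum_sub_one W κ L S₂ hγ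
  set h₁ := isLocNil_conjDatum_sub_one W κ L S₁ hγ
  set ι := AddSubgroup.inclusion (datumSelmerInfty_mono κ h12 (W.geomPrimaryTorsion p) L)
    with hι
  ext s
  obtain ⟨N, hN⟩ := h₁.nil s
  obtain ⟨k, hk⟩ := h₁.torsion s
  have hN₂ : ((conjDatum W κ L S₂ γ - 1) ^ N) (ι s) = 0 := by
    rw [hι, ← inclusion_conj_sub_one_pow_apply W κ γ L h12 N s, hN, map_zero]
  have hk₂ : p ^ k • ι s = 0 := by rw [← map_nsmul, hk, map_zero]
  rw [AddMonoidHom.comp_apply, h₂.smulFun_apply f x hN₂ hk₂, h₁.smulFun_apply f _ hN hk,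
    IwasawaDual.evalT_def, IwasawaDual.evalT_def]
  refine Finset.sum_congr rfl fun i _ ↦ ?_
  rw [AddMonoidHom.comp_apply, hι, inclusion_conj_sub_one_pow_apply W κ γ L h12 i s]

end Naturality

/-! ## §3. The dual `X₀ ↠ X` of `S^{S₁} ↪ S^{S₂}`: `Λ`-linear, surjective, kernel -/

section Restrict

variable {K : Type u} [Field K] [NumberField K] (W : WeierstrassCurve K) {p : ℕ} [Fact p.Prime]
  (κ : ZpExtension K p) {γ : absoluteGaloisGroup K} (L : Data K (W.geomPrimaryTorsion p) p)
  {S₁ S₂ : Set (HeightOneSpectrum (𝓞 K))} (h12 : S₁ ⊆ S₂)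

/-- **The Pontryagin dual `X₀ → X` of `S^{S₁} ↪ S^{S₂}` exists as a `Λ`-LINEAR SURJECTION** with
kernel `{x | toDual x kills S^{S₁}}` (restriction of characters transported through the two
`toDual`s: both actions are the canonical one by `DatumDualData.toDual_smul`, natural along the
inclusion by `smulFun_comp_inclusion`; onto because characters of a subgroup extend, `ℚ/ℤ` being
injective — Mathlib `CharacterModule.dual_surjective_of_injective`). Existence form, no definition.
GV 2000 Cor. (2.3): the dual of `0 → S_A → S^{Σ₀}_A`. [cite: GreenbergVatsal2000, §2 Cor. (2.3) (arXiv:math/9906215 pp. 20–21)] -/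
theorem exists_restrictDual (hγ : κ.IsTopGenerator γ)
    (X : DatumDualData κ γ (W.geomPrimaryTorsion p) L S₁)
    (X₀ : DatumDualData κ γ (W.geomPrimaryTorsion p) L S₂) :
    ∃ r : X₀.X →ₗ[IwasawaAlgebra p] X.X,
      (∀ x : X₀.X, X.toDual (r x) = (X₀.toDual x).comp (AddSubgroup.inclusion
        (datumSelmerInfty_mono κ h12 (W.geomPrimaryTorsion p) L))) ∧
      Function.Surjective r ∧
      ∀ x : X₀.X, r x = 0 ↔ ∀ s : datumSelmerInfty κ (W.geomPrimaryTorsion p) L S₁,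
        X₀.toDual x (AddSubgroup.inclusion
          (datumSelmerInfty_mono κ h12 (W.geomPrimaryTorsion p) L) s) = 0 := by
  set ι := AddSubgroup.inclusion (datumSelmerInfty_mono κ h12 (W.geomPrimaryTorsion p) L)
    with hι
  let e := AddEquiv.ofBijective X.toDual X.bijective
  have key : ∀ y, X.toDual (e.symm y) = y := fun y ↦ e.apply_symm_apply y
  let r : X₀.X →ₗ[IwasawaAlgebra p] X.X :=
    { toFun := fun x ↦ e.symm ((X₀.toDual x).comp ι)
      map_add' := fun x y ↦ by rw [← map_add, map_add, AddMonoidHom.add_comp]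
      map_smul' := fun f x ↦ by
        apply X.bijective.1
        rw [RingHom.id_apply, DatumDualData.toDual_smul hγ X, key, key,
          DatumDualData.toDual_smul hγ X₀, hι, smulFun_comp_inclusion W κ γ L h12 hγ] }
  have hr : ∀ x, X.toDual (r x) = (X₀.toDual x).comp ι := fun x ↦ key _
  refine ⟨r, hr, fun y ↦ ?_, fun x ↦ ?_⟩
  · -- surjective: extend the character `X.toDual y` of `S^{S₁}` to `S^{S₂}`
    obtain ⟨χ', hχ'⟩ := CharacterModule.dual_surjective_of_injective ι.toIntLinearMap
      (AddSubgroup.inclusion_injective (datumSelmerInfty_mono κ h12 (W.geomPrimaryTorsion p) L))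
      (X.toDual y)
    obtain ⟨x, hx⟩ := X₀.bijective.2 χ'
    refine ⟨x, X.bijective.1 ?_⟩
    rw [hr, hx]
    refine AddMonoidHom.ext fun s ↦ ?_
    have hs := DFunLike.congr_fun hχ' s
    rw [CharacterModule.dual_apply] at hs
    rw [AddMonoidHom.comp_apply]
    exact hs
  · -- kernel
    rw [← (injective_iff_map_eq_zero' _).1 X.bijective.1 (r x), hr]
    constructor
    · intro h s
      rw [← AddMonoidHom.comp_apply, h, AddMonoidHom.zero_apply]
    · intro h
      ext s
      rw [AddMonoidHom.comp_apply, h s, AddMonoidHom.zero_apply]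

end Restrict

/-! ## §4. A datum dual is a dual pair (`IwasawaDual.IsDualPair`) -/

section DualPair

variable {K : Type u} [Field K] [NumberField K] (W : WeierstrassCurve K) {p : ℕ} [Fact p.Prime]
  (κ : ZpExtension K p) {γ : absoluteGaloisGroup K} (L : Data K (W.geomPrimaryTorsion p) p)
  (S₀ : Set (HeightOneSpectrum (𝓞 K)))

/-- Every `DatumDualData` of `S^{S₀}_{E[p^∞]}(K_∞)` is an axiomatic Pontryagin dual pair for
`ψ = conj_γ − 1` (`conjDatum`): `toDual_T_smul`, `toDual_C_smul`, and local nilpotence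
`isLocNil_conjDatum_sub_one` for `γ` a topological generator — as `SelmerDualData.isDualPair`.
[cite: GreenbergLNM1716, §1 (after Conj. 1.3)] -/
theorem isDualPair_datumDualData (hγ : κ.IsTopGenerator γ)
    (D : DatumDualData κ γ (W.geomPrimaryTorsion p) L S₀) :
    IsDualPair p (conjDatum W κ L S₀ γ - 1) D.toDual where
  bijective := D.bijective
  T_smul x s := by
    rw [D.toDual_T_smul, IwasawaDual.End_sub_apply, AddMonoid.End.one_apply, map_sub]
    rfl
  C_smul c x s k hk := D.toDual_C_smul c x s k hk
  locNil := isLocNil_conjDatum_sub_one W κ L S₀ hγ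

end DualPair

end Summit.BirchSwinnertonDyer.Rank1Residual.Iwasawa

end
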